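import Literature.AlgebraicGeometry.Resolution.AlterationsStrongAlgClosedLeaves5
import Literature.AlgebraicGeometry.Resolution.Lemma411VertexChoiceHolds
import HarnessLib

/-!
# De Jong's alteration theorem (Thm. 4.1) from FOUR open leaves

Topic: `Literature/AlgebraicGeometry/Resolution`. Bookkeeping (pure composition: no definition,
no named fact) for the named facts `DeJong1996StrongAlgClosed` / `DeJong1996Strong` /
`DeJong1996StrongPerfect` (`AlterationsStrong.lean`; de Jong 1996, Thm. 4.1 with 4.3–4.28).
With the vertex choice of Lemma 4.11 discharged (`DeJong1996Lemma411VertexChoice_holds`,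
`Lemma411VertexChoiceHolds.lean`: generic linear projections, 2.11 and Bertini, p. 68) the
five-leaf assembly `DeJong1996Strong.of_openLeaves₅` (`AlterationsStrongAlgClosedLeaves5.lean`)
drops to FOUR named facts still open, none of them in 4.3–4.12:

* 4.13–4.22: `DeJong1996MultisectionHyperplane` (proof of Lemma 4.13, pp. 69–70),
  `DeJong1996StableExtension` (4.17 with 2.24, pp. 62, 71–72),
  `Stacks081R` (Raynaud–Gruson flattening, used in 4.18 through 2.19, pp. 60–61, 72);
* 4.23–4.28: `DeJong1996SemiStableCodimTwoBlowupCore` (the Claim of 3.4, pp. 63–64).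

The discharge `DeJong1996Strong_holds` is `(DeJong1996Strong.of_openLeaves₄ …).1` fed with the
four discharges.

## Sources

* A. J. de Jong, *Smoothness, semi-stability and alterations*, Publ. Math. IHÉS 83 (1996) 51–93:
  Thm. 4.1 (p. 66), 4.3–4.28 (pp. 66–76). [DeJong1996]
-/

noncomputable section

namespace Literature.AlgebraicGeometry.Resolution

universe u

/-- **4.11–4.28 (`DeJong1996NormalProjectiveStep`) from four open leaves**: the five-leaf
assembly with the vertex choice of 4.11 discharged. [cite: DeJong1996, 4.11–4.28, pp. 67–76] -/
theorem DeJong1996NormalProjectiveStep.of_openLeaves₄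
    -- 4.13–4.22
    (h13 : DeJong1996MultisectionHyperplane.{u}) (h17 : DeJong1996StableExtension.{u})
    (h081R : Stacks081R.{u})
    -- 4.23–4.28
    (hK : DeJong1996SemiStableCodimTwoBlowupCore.{u}) :
    DeJong1996NormalProjectiveStep.{u} :=
  DeJong1996NormalProjectiveStep.of_openLeaves₅ DeJong1996Lemma411VertexChoice_holds h13 h17 h081R hK

/-- **Thm. 4.1 with its generically-étale clause over algebraically closed fields
(`DeJong1996StrongAlgClosed`) from four open leaves.**
[cite: DeJong1996, Thm. 4.1 and 4.3–4.28, pp. 66–76] -/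
theorem DeJong1996StrongAlgClosed.of_openLeaves₄
    (h13 : DeJong1996MultisectionHyperplane.{u}) (h17 : DeJong1996StableExtension.{u})
    (h081R : Stacks081R.{u}) (hK : DeJong1996SemiStableCodimTwoBlowupCore.{u}) :
    DeJong1996StrongAlgClosed.{u} :=
  DeJong1996StrongAlgClosed.of_openLeaves₅ DeJong1996Lemma411VertexChoice_holds h13 h17 h081R hK

/-- … and Thm. 4.1 (i)+(ii) over every field (`DeJong1996Strong`), its last sentence over
perfect fields (`DeJong1996StrongPerfect`), (i) alone and the weak form, from the same four
leaves. [cite: DeJong1996, Thm. 4.1, p. 66] -/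
theorem DeJong1996Strong.of_openLeaves₄
    (h13 : DeJong1996MultisectionHyperplane.{u}) (h17 : DeJong1996StableExtension.{u})
    (h081R : Stacks081R.{u}) (hK : DeJong1996SemiStableCodimTwoBlowupCore.{u}) :
    DeJong1996Strong.{u} ∧ DeJong1996StrongPerfect.{u} ∧ DeJong1996Projective.{u} ∧
      DeJong1996.{u} :=
  DeJong1996Strong.of_openLeaves₅ DeJong1996Lemma411VertexChoice_holds h13 h17 h081R hK

end Literature.AlgebraicGeometry.Resolution

end
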